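import Summits.AtomisticToContinuum.HydrodynamicLimit.Theorems.JParityClosureParityBandClosureWindowCovarianceIsotropyD
import HarnessLib

/-!
# Window covariance isotropy (crux `JParityClosure.ParityBandClosure`, stmt-AtomisticToContinuum-17608, line
# `transfer-weighted-parity-chain`, stub `stub_windowCovarianceIsotropy`) — helper E: the balance defect of the
# window record is `O(ε_N)`

WHAT.  `abs_balance_wrec_le`: along a hard-sphere trajectory on `𝕋³` (`0 < ε < 1/2`), for every window `(t₀, x₀)`,
every bounded mark `c` and `0 ≤ τ`,
`|∫ (c(v′) + c(w′) − c(v) − c(w)) dκ_w| ≤ ε (2(2B + L(τ+1))) + ε (r⁻² · 3/(πr⁴) · 2‖c‖) · Λ`,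
`B = r⁻² 3/(πr³) ‖c‖`, `L = ‖c‖(r⁻⁴ 3/(πr³) + r⁻² 3/(πr⁴)(1/2 + E/(N+1)))`, `E` the (conserved) kinetic energy,
`Λ = (ε/(N+1)) Σ_{ordered contact events in [0,τ]} 1` — uniformly in the window.  Assembly of helper D: the
balance integrand is the pair sum of `cone(xᵢ)[(c(vᵢ) − c(vᵢ⁻)) + (c(vⱼ) − c(vⱼ⁻))]`; the second half is the
first half with weight `cone(xⱼ)` (swap); twice the first half is `2(N+1)` times the jump sum of the window
observable, bounded by summation by parts; the weight mismatch costs `3/(πr⁴) · ε` per event.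

REFERENCES.  H. Spohn, *Large Scale Dynamics of Interacting Particles* (1991), Part I §3.2; N. N. Bogolyubov,
Theor. Math. Phys. 24 (1975).  No named fact is invoked.
-/

noncomputable section

namespace Summit.AtomisticToContinuum.HydrodynamicLimit.Theorems.ParityBandClosureWindowCovariance

open scoped BigOperators Topology Classical MeasureTheory ENNReal InnerProductSpace
open Filter Set MeasureTheory Function Topology
open Literature.MathematicalPhysics.KineticTheory
open Literature.Analysis.FluidPDE
open Summit.AtomisticToContinuum.HydrodynamicLimit.Theorems.LocalSecondLawNegative (cone cone_nonneg cone_le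
  continuous_cone integral_cone_le)

variable {N : ℕ}

section Balance

variable {ε r τ t₀ : ℝ} {x₀ : T3} {γ : ℝ → Config (N + 1) (Fin 3) T3} {c : V3 → ℝ} {Cc : ℝ}

/-- A window `(a, τ]` with `−1 ≤ a < 0` carrying the same collisions as `[0, τ]` (collision times are locally
finite, so some left neighbourhood of `0` is collision-free). [folklore] -/
theorem exists_Ioc_eq_Icc (hγ : IsHardSphereTrajectory (Torus.geometry (Fin 3)) ε (N + 1) γ) (τ : ℝ) :
    ∃ a : ℝ, -1 ≤ a ∧ a < 0 ∧ collisionTimes (Torus.geometry (Fin 3)) ε γ ∩ Set.Ioc a τ =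
      collisionTimes (Torus.geometry (Fin 3)) ε γ ∩ Set.Icc 0 τ := by
  obtain ⟨a₀, ha₀, hfree⟩ := hγ.exists_Ioo_left_free 0
  refine ⟨max a₀ (-1), le_max_right _ _, max_lt ha₀ (by norm_num), Set.ext fun t => ⟨?_, ?_⟩⟩
  · rintro ⟨ht, hat, htτ⟩
    refine ⟨ht, ?_, htτ⟩
    by_contra h0
    exact hfree t ⟨(le_max_left _ _).trans_lt hat, not_le.1 h0⟩ ht
  · rintro ⟨ht, h0t, htτ⟩
    exact ⟨ht, (max_lt ha₀ (by norm_num)).trans_le h0t, htτ⟩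

/-- **The jump sum of the window observable over the collisions of `[0, τ]` is bounded, uniformly in the window.**
[folklore] -/
theorem abs_collisionPairSum_jump_le (hγ : IsHardSphereTrajectory (Torus.geometry (Fin 3)) ε (N + 1) γ) (hr : 0 < r)
    (hτ : 0 ≤ τ) (hc : ∀ v, |c v| ≤ Cc) :
    |collisionPairSum (Torus.geometry (Fin 3)) ε γ (Set.Icc 0 τ) (fun t i j =>
        btent r (t - t₀) * ((N + 1 : ℕ) : ℝ)⁻¹ * (cone r (γ t i).1 x₀ * (c (γ t i).2 -
          c (reflectVel ((Torus.geometry (Fin 3)).sepVec (γ t i).1 (γ t j).1) ((γ t i).2, (γ t j).2)).1)))| ≤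
      2 * ((r ^ 2)⁻¹ * (3 / (Real.pi * r ^ 3) * Cc)) +
        Cc * ((r ^ 2)⁻¹ * (r ^ 2)⁻¹ * (3 / (Real.pi * r ^ 3)) +
          (r ^ 2)⁻¹ * (3 / (Real.pi * r ^ 4)) * (1 / 2 + ((N + 1 : ℕ) : ℝ)⁻¹ * configEnergy (γ 0))) * (τ + 1) := by
  obtain ⟨a, ha1, ha0, hset⟩ := exists_Ioc_eq_Icc hγ τ
  have hG : ∀ x : T3, Continuous ((Torus.geometry (Fin 3)).translate x) := fun x =>
    continuous_const.add Literature.Analysis.FunctionSpaces.Torus.continuous_proj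
  have hS : collisionPairSum (Torus.geometry (Fin 3)) ε γ (Set.Icc 0 τ) (fun t i j =>
        btent r (t - t₀) * ((N + 1 : ℕ) : ℝ)⁻¹ * (cone r (γ t i).1 x₀ * (c (γ t i).2 -
          c (reflectVel ((Torus.geometry (Fin 3)).sepVec (γ t i).1 (γ t j).1) ((γ t i).2, (γ t j).2)).1))) =
      ∑ᶠ t ∈ collisionTimes (Torus.geometry (Fin 3)) ε γ ∩ Set.Ioc a τ, collisionJump (balObs r t₀ x₀ c t) γ t := by
    rw [finsum_collisionJump_balObs_eq hγ]
    unfold collisionPairSum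
    rw [hset]
  rw [hS]
  set L := Cc * ((r ^ 2)⁻¹ * (r ^ 2)⁻¹ * (3 / (Real.pi * r ^ 3)) +
    (r ^ 2)⁻¹ * (3 / (Real.pi * r ^ 4)) * (1 / 2 + ((N + 1 : ℕ) : ℝ)⁻¹ * configEnergy (γ 0))) with hLdef
  have hL : ∀ t₁ s s', |balObs r t₀ x₀ c s (freeFlight (Torus.geometry (Fin 3)) (s - t₁) (γ t₁)) -
      balObs r t₀ x₀ c s' (freeFlight (Torus.geometry (Fin 3)) (s' - t₁) (γ t₁))| ≤ L * |s - s'| := by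
    intro t₁ s s'
    have h := abs_balObs_freeFlight_sub_le (t₀ := t₀) (x₀ := x₀) hr hc (γ t₁) t₁ s s'
    rwa [IsHardSphereTrajectory.configEnergy_eq_holds hγ t₁ 0] at h
  have hj := abs_finsum_collisionJump_le hγ hG (fun s w => abs_balObs_le (t₀ := t₀) (x₀ := x₀) hr hc s w) hL
    (show a ≤ τ by linarith)
  refine hj.trans ?_
  have hCc : 0 ≤ Cc := (abs_nonneg _).trans (hc 0)
  have hE : 0 ≤ ((N + 1 : ℕ) : ℝ)⁻¹ * configEnergy (γ 0) := by unfold configEnergy; positivity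
  have hL0 : 0 ≤ L := by rw [hLdef]; positivity
  nlinarith

/-- **The balance defect of the window record is `O(ε)`**, uniformly in the window (see the module docstring for
the constants). [folklore] -/
theorem abs_balance_wrec_le (hγ : IsHardSphereTrajectory (Torus.geometry (Fin 3)) ε (N + 1) γ) (hε : 0 < ε)
    (hε2 : ε < 2⁻¹) (hr : 0 < r) (hτ : 0 ≤ τ) (hc : ∀ v, |c v| ≤ Cc) :
    |∫ q, (c (collide q.2 q.1).1 + c (collide q.2 q.1).2 - c q.1.1 - c q.1.2) ∂(wrec ε r τ t₀ x₀ γ)| ≤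
      ε * (2 * (2 * ((r ^ 2)⁻¹ * (3 / (Real.pi * r ^ 3) * Cc)) +
        Cc * ((r ^ 2)⁻¹ * (r ^ 2)⁻¹ * (3 / (Real.pi * r ^ 3)) +
          (r ^ 2)⁻¹ * (3 / (Real.pi * r ^ 4)) * (1 / 2 + ((N + 1 : ℕ) : ℝ)⁻¹ * configEnergy (γ 0))) * (τ + 1))) +
      ε * ((r ^ 2)⁻¹ * (3 / (Real.pi * r ^ 4)) * (2 * Cc)) *
        (ε / (N + 1 : ℝ) * collisionPairSum (Torus.geometry (Fin 3)) ε γ (Set.Icc 0 τ) fun _ _ _ => (1 : ℝ)) := by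
  have hfin := finite_collisionTimes_Icc hγ τ
  have hCc : 0 ≤ Cc := (abs_nonneg _).trans (hc 0)
  -- names for the summands
  set G3 := Torus.geometry (Fin 3) with hG3
  set δ₁ : ℝ → Fin (N + 1) → Fin (N + 1) → ℝ := fun s i j =>
    c (γ s i).2 - c (reflectVel (G3.sepVec (γ s i).1 (γ s j).1) ((γ s i).2, (γ s j).2)).1 with hδ₁
  set δ₂ : ℝ → Fin (N + 1) → Fin (N + 1) → ℝ := fun s i j =>
    c (γ s j).2 - c (reflectVel (G3.sepVec (γ s i).1 (γ s j).1) ((γ s i).2, (γ s j).2)).2 with hδ₂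
  set gA : ℝ → Fin (N + 1) → Fin (N + 1) → ℝ := fun s i j => btent r (s - t₀) * cone r (γ s i).1 x₀ * δ₁ s i j
    with hgA
  set gB : ℝ → Fin (N + 1) → Fin (N + 1) → ℝ := fun s i j => btent r (s - t₀) * cone r (γ s i).1 x₀ * δ₂ s i j
    with hgB
  set gB' : ℝ → Fin (N + 1) → Fin (N + 1) → ℝ := fun s i j => btent r (s - t₀) * cone r (γ s j).1 x₀ * δ₁ s i j
    with hgB'
  set gD : ℝ → Fin (N + 1) → Fin (N + 1) → ℝ := fun s i j =>
    btent r (s - t₀) * (cone r (γ s j).1 x₀ - cone r (γ s i).1 x₀) * δ₁ s i j with hgD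
  set J : ℝ → Fin (N + 1) → Fin (N + 1) → ℝ := fun s i j =>
    btent r (s - t₀) * ((N + 1 : ℕ) : ℝ)⁻¹ * (cone r (γ s i).1 x₀ * δ₁ s i j) with hJ
  have hδb : ∀ s i j, |δ₁ s i j| ≤ 2 * Cc := fun s i j => by
    have ha := hc (γ s i).2
    have hb := hc (reflectVel (G3.sepVec (γ s i).1 (γ s j).1) ((γ s i).2, (γ s j).2)).1
    rw [hδ₁]
    exact (abs_sub _ _).trans (by linarith)
  -- ### the algebra of the pair sums
  have h1 : ∫ q, (c (collide q.2 q.1).1 + c (collide q.2 q.1).2 - c q.1.1 - c q.1.2) ∂(wrec ε r τ t₀ x₀ γ) =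
      ε / (N + 1 : ℝ) * (collisionPairSum G3 ε γ (Set.Icc 0 τ) gA + collisionPairSum G3 ε γ (Set.Icc 0 τ) gB) := by
    rw [integral_balance_wrec_eq hγ hε hr c, ← collisionPairSum_add hfin]
    congr 1
    refine collisionPairSum_congr fun t _ p _ => ?_
    simp only [hgA, hgB, hδ₁, hδ₂]
    ring
  have h2 : collisionPairSum G3 ε γ (Set.Icc 0 τ) gB = collisionPairSum G3 ε γ (Set.Icc 0 τ) gB' :=
    collisionPairSum_secondHalf_eq hγ hε2 (Set.Icc 0 τ) (fun s => btent r (s - t₀)) c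
  have h3 : collisionPairSum G3 ε γ (Set.Icc 0 τ) gB' =
      collisionPairSum G3 ε γ (Set.Icc 0 τ) gA + collisionPairSum G3 ε γ (Set.Icc 0 τ) gD := by
    rw [← collisionPairSum_add hfin]
    refine collisionPairSum_congr fun t _ p _ => ?_
    simp only [hgA, hgB', hgD]
    ring
  have h4 : collisionPairSum G3 ε γ (Set.Icc 0 τ) gA = ((N + 1 : ℕ) : ℝ) * collisionPairSum G3 ε γ (Set.Icc 0 τ) J := by
    rw [← collisionPairSum_const_mul hfin]
    refine collisionPairSum_congr fun t _ p _ => ?_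
    simp only [hgA, hJ]
    field_simp
  -- ### the two bounds
  have hJb := abs_collisionPairSum_jump_le (t₀ := t₀) (x₀ := x₀) hγ hr hτ hc
  have hDb : |collisionPairSum G3 ε γ (Set.Icc 0 τ) gD| ≤
      (r ^ 2)⁻¹ * (3 / (Real.pi * r ^ 4)) * ε * (2 * Cc) * collisionPairSum G3 ε γ (Set.Icc 0 τ) fun _ _ _ => (1 : ℝ) := by
    have hpt : ∀ t ∈ collisionTimes G3 ε γ ∩ Set.Icc 0 τ, ∀ p ∈ contactPairs G3 ε (γ t),
        |gD t p.1 p.2| ≤ (r ^ 2)⁻¹ * (3 / (Real.pi * r ^ 4)) * ε * (2 * Cc) * 1 := by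
      intro t _ p hp
      obtain ⟨_, hsep⟩ := (mem_contactPairs_iff_of_mem (hγ.mem t)).1 hp
      rw [hgD]
      simp only [mul_one]
      rw [abs_mul, abs_mul, abs_of_nonneg (btent_nonneg _ _)]
      have hcone : |cone r (γ t p.2).1 x₀ - cone r (γ t p.1).1 x₀| ≤ 3 / (Real.pi * r ^ 4) * ε := by
        have h := gridUp_abs_cone_sub_cone_le hr (γ t p.2).1 (γ t p.1).1 x₀
        refine h.trans (le_of_eq ?_)
        rw [Torus.euclidDist_comm, ← Torus.norm_geometry_sepVec, hsep]
      calc btent r (t - t₀) * |cone r (γ t p.2).1 x₀ - cone r (γ t p.1).1 x₀| * |δ₁ t p.1 p.2|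
          ≤ (r ^ 2)⁻¹ * (3 / (Real.pi * r ^ 4) * ε) * (2 * Cc) :=
            mul_le_mul (mul_le_mul (btent_le _ _) hcone (abs_nonneg _) (by positivity)) (hδb _ _ _)
              (abs_nonneg _) (by positivity)
        _ = _ := by ring
    rw [abs_le]
    constructor
    · have hm := collisionPairSum_mono hfin (g := fun t i j => -((r ^ 2)⁻¹ * (3 / (Real.pi * r ^ 4)) * ε * (2 * Cc) * 1))
        (g' := gD) fun t ht p hp => (abs_le.1 (hpt t ht p hp)).1
      rw [show (fun (t : ℝ) (i j : Fin (N + 1)) => -((r ^ 2)⁻¹ * (3 / (Real.pi * r ^ 4)) * ε * (2 * Cc) * 1)) =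
        fun t i j => -((r ^ 2)⁻¹ * (3 / (Real.pi * r ^ 4)) * ε * (2 * Cc)) * (1 : ℝ) from by funext; ring,
        collisionPairSum_const_mul hfin] at hm
      linarith
    · have hm := collisionPairSum_mono hfin (g := gD)
        (g' := fun t i j => (r ^ 2)⁻¹ * (3 / (Real.pi * r ^ 4)) * ε * (2 * Cc) * 1) fun t ht p hp =>
          (abs_le.1 (hpt t ht p hp)).2
      rw [collisionPairSum_const_mul hfin] at hm
      exact hm
  -- ### assembly
  have hε1 : 0 ≤ ε / (N + 1 : ℝ) := div_nonneg hε.le (by positivity)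
  rw [h1, h2, h3, ← add_assoc, ← two_mul, h4, mul_add]
  refine (abs_add_le _ _).trans (add_le_add ?_ ?_)
  · rw [abs_mul, abs_of_nonneg hε1, abs_mul, abs_mul, abs_of_pos (by positivity : (0 : ℝ) < 2),
      abs_of_pos (by positivity : (0 : ℝ) < ((N + 1 : ℕ) : ℝ))]
    have hN : ε / (N + 1 : ℝ) * (2 * (((N + 1 : ℕ) : ℝ) * |collisionPairSum G3 ε γ (Set.Icc 0 τ) J|)) =
        ε * (2 * |collisionPairSum G3 ε γ (Set.Icc 0 τ) J|) := by
      push_cast; field_simp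
    rw [hN]
    exact mul_le_mul_of_nonneg_left (mul_le_mul_of_nonneg_left hJb (by norm_num)) hε.le
  · rw [abs_mul, abs_of_nonneg hε1]
    calc ε / (N + 1 : ℝ) * |collisionPairSum G3 ε γ (Set.Icc 0 τ) gD|
        ≤ ε / (N + 1 : ℝ) * ((r ^ 2)⁻¹ * (3 / (Real.pi * r ^ 4)) * ε * (2 * Cc) *
            collisionPairSum G3 ε γ (Set.Icc 0 τ) fun _ _ _ => (1 : ℝ)) := mul_le_mul_of_nonneg_left hDb hε1
      _ = _ := by ring

/-- **Registered sub-goal `stub_wciLeftFreeWindow` (helper E of `stub_windowCovarianceIsotropy`): the collisions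
of `[0, τ]` are those of some `(a, τ]` with `−1 ≤ a < 0`** (local finiteness of the collision times), which puts the
closed window of the kinetic inputs in the half-open format of the summation by parts. [folklore] -/
theorem stub_wciLeftFreeWindow : ∀ {N : ℕ} {ε : ℝ} {γ : ℝ → Config (N + 1) (Fin 3) T3}, IsHardSphereTrajectory (Torus.geometry (Fin 3)) ε (N + 1) γ → ∀ τ : ℝ, ∃ a : ℝ, -1 ≤ a ∧ a < 0 ∧ collisionTimes (Torus.geometry (Fin 3)) ε γ ∩ Set.Ioc a τ = collisionTimes (Torus.geometry (Fin 3)) ε γ ∩ Set.Icc 0 τ :=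
  fun hγ τ => exists_Ioc_eq_Icc hγ τ

end Balance

end Summit.AtomisticToContinuum.HydrodynamicLimit.Theorems.ParityBandClosureWindowCovariance

end
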